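import Mathlib
import HarnessLib
import HarnessLib.Audit
import Summits.RiemannHypothesis.Statement
import Literature.NumberTheory.LFunctions.WeilExplicit
import Literature.NumberTheory.LFunctions.WeilCriterionConverse
import Literature.NumberTheory.LFunctions.GeneralizedRH
import HarnessLib.Audit.Status.Attr

/-!
Route: WeilRadar

# Route WeilRadar — effective Weil converse — cone positivity at window 10(log T)^3/η clears the
zero box (η,T); RH splits as high zeros + floor + one prime-side certificate

LINE «WEIL RADAR» of LADDER-RH (rh-idea-9 g3, technique card ASSUME-THE-OPPOSITE on the prime side,
D-0145/ORDER (II)).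
It suffices to show X = TranslateMixWindow ∧ RadarGrowth ∧ RadarResidual. The two RH-FREE conjuncts
make the tree's
ineffective Weil converse (`WeilConverse.riemannHypothesis_of_zeroSide_nonneg`: positivity on ALL
cones ⇒ RH, via an
identity theorem) EFFECTIVE: Weil positivity on the single cone [−A, A] with A = 10(log T)^3/η
already excludes every zero
with |β − 1/2| ≥ η and |γ| ≤ T (an off-line zero makes the zero-side exponential sum B_g of a
height-γ packet grow like
e^{ηx}, and windowed polarisation caps B_g by Re Q(g) on |x| ≤ A − 1). The third conjunct is the
declared RESIDUAL
(RH-implied, never staffed): for some (H, η), zeros above height H are on the line, zeros below H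
are on the line or at
offset ≥ η, and Weil positivity holds on the one cone of window 10(log H)^3/η — no conjunct is
RH-equivalent by a tree
theorem. No summit is proved by a line; nothing here bears on the truth of RH.
Lean: `TranslateMixWindow ∧ RadarGrowth ∧ RadarResidual`

## Assembly
Pure logic over the strip form of RH (`riemannHypothesis_iff_strip_holds`): given the residual's (H,
η), a strip zero above
height H is on the line by RHAbove; one of height ≤ H is on the line or has offset ≥ η by
OffsetFloor, and in the latter case
RadarGrowth produces (g, x) with Re Q(g) < ‖B_g(x)‖ and 1 + |x| ≤ 10(log H)^3/η while
TranslateMixWindow with the residual's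
cone certificate gives ‖B_g(x)‖ ≤ Re Q(g) — contradiction. `closes` in glue.lean is this ten-line
term and uses all three items.

Rationale: WHY THIS LINE. Mechanism: Weil's explicit formula read as a RADAR — the prime side W(g⋆g̃) = zero
side Q(g) = Σ_ρ m(ρ)P_g(ρ); for the
translate family g + c·g_x (support window 1 + |x|) positivity polarises to |B_g(x)| ≤ Re Q(g) with
B_g(x) = Σ_ρ m P_g(ρ)e^{(ρ−1/2)x} (tree: `WeilConverse.norm_expSum_le`, Bombieri2000Weil Thm 1),
while an off-line zero
of offset η at height ≤ T contributes a term of modulus ≍ e^{ηx} which a Turán–Nazarov power-sum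
lower bound (Nazarov 1993,
Algebra i Analiz 5(4); Montgomery2007 ch. 5 for Turán's first main theorem) extracts from the O(log
T) on-line background
(`abs_zetaZeroCount_sub_main_le_explicit`) within |x| ≤ 10(log T)^3/η. Imported areas: harmonic
analysis of exponential
sums (Turán–Nazarov), Gevrey-class packets (transform decay e^{−c√|ξ|} bounds the leakage range).
What it does that listed
routes do not: WeilHeightWindowBarrier / WeilAdversary (rh-idea-4) bound what CERTIFIED HEIGHT can
buy (windows ≤ 1.2–19);
this line is the converse direction — what a cone certificate BUYS in zeros, with an explicit window
↔ (height, offset)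
exchange rate — and it yields a non-degenerate splitting RH ⟺ RHAbove(H) ∧ OffsetFloor(η,H) ∧
WeilPositivityOn(10(log H)^3/η)
complementary to x-wuc's RH ⟺ RH(e^1024) ∧ B′₁ (it can replace the unverifiable RH(e^1024) half by a
floor + one certificate).

RANKED CRUXES. #2 RadarGrowth (crux) — RADAR GROWTH LAW (RH-free). For 0 < η ≤ 1/2, T ≥ 16 and a
zero s of ζ with 0 < Re s < 1, |Im s| ≤ T, |Re s − 1/2| ≥ η, there is a window-1 Weil test function
g (a modulated Gevrey packet at height Im s) and a translate x with 1 + |x| ≤ 10(log T)^3/η such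
that Re Q(g) < ‖B_g(x)‖ (tree decls `WeilConverse.zeroForm`, `WeilConverse.expSum`). [difficulty: L]
(why it might fail: near-equal-offset off-line multiplets inside the packet's leakage range can
cancel in B_g on [0, A−1]; Turán–Nazarov costs e^{O(n)}, n ≤ #zeros in a height window of size
O(log² A), and 10(log T)^3/η is sized to absorb exactly that.) [Bombieri2000Weil, Montgomery2007,
corpus:book:montgomery2007-multiplicative-number-theory-i-classical-theory p319]
#3 RadarResidual (crux) — RESIDUAL (RH-implied, declared residual, never staffed): there are H ≥ 16
and η ∈ (0, 1/2] such that every zero of ζ in the critical strip with |Im s| > H has Re s = 1/2,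
every zero with |Im s| ≤ H has Re s = 1/2 or |Re s − 1/2| ≥ η, and Weil positivity holds on the cone
of window 10(log H)^3/η (prime side: n ≤ H^{10(log H)^2/η}). [difficulty: open-problem] (why it
might fail: it fails iff RH fails (then no (H, η) works); as a residual its risk is epistemic: no
method certifies WeilPositivityOn beyond window ≈ 2.1 (tree H(q) programme) or proves RH above any
height.) [Bombieri2000Weil, Yoshida1992, PlattTrudgianBLMS2021]
#9 TranslateMixWindow (support) — WINDOWED POLARISATION: if g is a Weil test function supported in
[−a, a] (a ≥ 0) and Weil positivity holds on [−A, A], then ‖B_g(x)‖ ≤ Re Q(g) for every x with a +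
|x| ≤ A (the tree's `norm_expSum_le` with the support of `translateMix g c x` tracked; explicit
formula `explicit_formula_holds` identifies W(h⋆h̃) with Q(h)). [difficulty: provable-now]
[Bombieri2000Weil]

TWO-LAYER PLAN. RadarGrowth ⇐ PacketBudget → GrowthExtraction → RadarGrowth: PacketBudget = a
window-1 modulated Gevrey packet g at height γ₀
with ‖P_g(s)‖ ≥ 1/2 at the given zero, Re Q(g) ≤ 40 log T and weighted leakage Σ_ρ
m‖P_g(ρ)‖e^{c√|γ−γ₀|} ≤ 40 log T (zero
counting + transform decay); GrowthExtraction = for any g with that budget and an off-line zero of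
offset ≥ η in its support,
sup over |x| ≤ 10(log T)^3/η − 1 of ‖B_g(x)‖ exceeds 40 log T (Turán–Nazarov on the top-offset
family). Filed only after birth.

KILL CRITERIA. Refutation of RadarGrowth by an ADMISSIBLE configuration argument does not apply (it
quantifies over the actual zeros of ζ);
it is killed outright by a proof that for some explicit (η, T) and zero pattern consistent with all
proved zero-counting
bounds the sum B_g stays below Re Q(g) on the whole window for EVERY window-1 test g — i.e. a
phantom undetectable at window
10(log T)^3/η (compare WeilHeightWindowBarrier.PhantomLaw, which lives at window ≤ 1.2). A proof of
RadarGrowth with window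
C·log T·(log log T)²/η or better supersedes the constant. RadarResidual is refuted iff RH is (route
closes refuted:RadarResidual).

NOT DECOMPOSED YET. The packet construction (Gevrey bump, modulation), the leakage range, the
top-offset selection with an ε-margin over
dyadic height scales, and the Turán–Nazarov constant are all inside RadarGrowth; the window exponent
3 is a safety margin
(the expected truth is C(log log T + log(1/η))/η under an integer-multiplicity cancellation lemma, C
log T (log log T)²/η by
Turán–Nazarov alone) and is not optimised at open.

CHEAPEST FALSIFIER. Bombieri's fictitious-zero experiment (Bombieri2000Weil §11 footnote 11, p. 221:
ρ₀ = 0.52 + 3.14i, N ≤ 160 zeros,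
support [1/M₀, M₀]): compute, for a planted quadruple at (η, γ₀) = (0.02, 3.14) added to the first
10^4 zeros, the smallest
translate range X at which max_{|x|≤X} ‖B_g(x)‖ > Re Q(g) for the Gaussian-type window-1 packet; the
line dies if X grows
faster than (log T)^3/η along γ₀ ∈ {10^2, 10^3, 10^4} (T = γ₀ + 16). Not yet run (kit job to be
filed by the first prover;
the binomial-cluster obstruction computed in NOTES shows single-profile packets alone need X ≳
n/(3η) against an n-fold
cluster, which zero counting caps at n ≲ 0.2 log T).

NUMBERS. Window today certified: WeilPositivityOn a for a ≤ 2/5 and the H(q) programme's ≈ 2.1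
(tree: `weilPositivityOn_of_le_two_fifths`,
Theses H(q)); height-certification ceiling ≈ 1.2 → 19.3 (WeilHeightWindowBarrier); RH verified to
3·10^12
(PlattTrudgianBLMS2021); the residual at (H, η) = (3·10^12, 0.1) asks window 10·(28.7)^3/0.1 ≈
2.4·10^6.

DEFINITION REQUESTS. None: all items are stated over `WeilPositivityOn`, `WeilConverse.zeroForm`,
`WeilConverse.expSum`, `IsWeilTest`, `riemannZeta`.

Novelty: Searches (2026-08-28): lit search --hybrid "Weil explicit formula positivity test functions compact
support implies zero free region effective" (8 docs, none on point: Montgomery2007 p319,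
Lapidus2006, JorgensonLang1994); lit vsearch "<the door in prose>" (8, none: MV2007, Titchmarsh1986,
Aubert–Bombieri–Goldfeld 1989 trace-formula volume); lit search "Weil explicit formula positivity
criterion effective zero-free region" --source all (local 8 half-term hits: arXiv:2602.04022,
arXiv:2310.18423, Connes 1997; remote crossref 8, none on point); lit search "Li criterion zero-free
regions Brown" --source all (Brown 2005 doi:10.1016/j.jnt.2004.07.016; arXiv:1807.01506;
arXiv:math/0507368); lit galaxy search "Weil's criterion|Weil positivity|Li's criterion and
zero-free" --star all (15 rows; on point only pdf:4005501466549090220 = Bombieri2000Weil); lit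
galaxy search "power sum method|Turán's method|Nazarov's lemma" --star pdf (8, none on point); tree:
rg WeilCriterionConverse (ineffective identity-theorem converse only), Theses
WeilHeightWindowBarrier / WeilAdversary (certification direction).
Nearest prior art found: Brown 2005 [doi:10.1016/j.jnt.2004.07.016] (Li's criterion ⇒ zero-free
regions: positivity of λ_n, n ≤ N buys a zero-free region) and arXiv:1807.01506 (explicit zero-free
regions ⇔ τ-Li criterion) — the Li-side analogue; Bombieri2000Weil Thm 11 + Corollary
[corpus:paper:galaxy-pdf-4005501466549090220 p36-37] (one-cone positivity ⇒ RH ∨ infinitely many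
off-line zeros ∨  [refs: 10.1016/j.jnt.2004.07.016, 2602.04022, 2310.18423, 1807.01506, math/0507368, doi:10.1016/j.jnt.2004.07.016, paper:galaxy-pdf-4005501466549090220, Titchmarsh1986]

Barriers (technique_class: explicit-formula, weil-positivity, turan-power-sum): - technique_class: explicit-formula, weil-positivity, turan-power-sum
- Literature.Barriers.RiemannHypothesis.BoundedFluctuationCounting: outside — the growth law uses
only the proved explicit bound |N(T) − main| ≤ 0.11 log T + 0.29 log log T + 2.29
(`abs_zetaZeroCount_sub_main_le_explicit`) for the on-line background and the multiplet size; it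
never assumes bounded S(T), and the (log T)^3 window absorbs Selberg-size fluctuations.
- Literature.Barriers.RiemannHypothesis.DavenportHeilbronn: outside — the line never asserts Weil
positivity; RadarGrowth is a spectral-side growth statement that holds verbatim for any Dirichlet
series with an explicit formula, and for Davenport–Heilbronn / Epstein zetas (off-line zeros, no
Euler product) it correctly predicts FAILURE of cone positivity at window 10(log T)^3/η; the Euler
product enters only through the residual's prime-side certificate, which is where ζ is distinguished
from the tower.
- Literature.Barriers.RiemannHypothesis.BrouckeDebruyneRevesz2023_thm13: outside — Beurling
generalised-prime systems with off-line zeros satisfy the analogue of RadarGrowth (their cone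
positivity FAILS at the radar window); the line never argues from zero-counting consistency to RH,
so the Beurling shadow does not bite; the residual's certificate is about the rational primes.
- Negatives index: the four refuted RH statements (`ledger negatives`) concern K-CERT
(`not_kCertL`), screw nodes and supply exponents; none is a Weil-window statement; RadarGr

sub-problem: RiemannHypothesis · status: draft · opened planner-rh-idea-9-g3-0 2026-08-28T00:23:00Z · rev 0 · ledger route-RiemannHypothesis-WeilRadar
GENERATED by the gate from the ledger (D-0016/17). Provers cite these decls: `theorem foo : Summit.RiemannHypothesis.RiemannHypothesis.Theses.WeilRadar.<Decl> := …` in Summits/RiemannHypothesis/RiemannHypothesis/Theorems/<Name>.lean.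
-/

namespace Summit.RiemannHypothesis.RiemannHypothesis.Theses.WeilRadar

open scoped BigOperators Topology Manifold Classical MeasureTheory ProbabilityTheory Matrix InnerProductSpace ComplexConjugate ContinuousMap
open Filter Set Function TopologicalSpace MeasureTheory

attribute [summit_statement] _root_.Summit.RiemannHypothesis

open Summit

/-- item stmt-RiemannHypothesis-24072 · crux · rank 2 · open · by planner
why it might fail: near-equal-offset off-line multiplets inside the packet's leakage range can cancel in B_g on [0, A−1]; Turán–Nazarov costs e^{O(n)}, n ≤ #zeros in a height window of size O(log² A), and 10(log T)^3/η is sized to absorb exactly that.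
sources: Bombieri2000Weil, Montgomery2007, corpus:book:montgomery2007-multiplicative-number-theory-i-classical-theory p319
[crux] RADAR GROWTH LAW (RH-free). For 0 < η ≤ 1/2, T ≥ 16 and a zero s of ζ with 0 < Re s < 1, |Im
s| ≤ T, |Re s − 1/2| ≥ η, there is a window-1 Weil test function g (a modulated Gevrey packet at
height Im s) and a translate x with 1 + |x| ≤ 10(log T)^3/η such that Re Q(g) < ‖B_g(x)‖ (tree decls
`WeilConverse.zeroForm`, `WeilConverse.expSum`). [difficulty: L] -/
@[route_item "route-RiemannHypothesis-WeilRadar", crux]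
def RadarGrowth : Prop :=
  ∀ η T : ℝ, 0 < η → η ≤ 1 / 2 → 16 ≤ T → ∀ s : ℂ, riemannZeta s = 0 → 0 < s.re → s.re < 1 → |s.im| ≤ T → η ≤ |s.re - 1 / 2| → ∃ g : ℝ → ℂ, Literature.NumberTheory.LFunctions.IsWeilTest g ∧ tsupport g ⊆ Set.Icc (-1) 1 ∧ ∃ x : ℝ, 1 + |x| ≤ 10 * Real.log T ^ 3 / η ∧ (Literature.NumberTheory.LFunctions.WeilConverse.zeroForm g).re < ‖Literature.NumberTheory.LFunctions.WeilConverse.expSum g x‖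

/-- item stmt-RiemannHypothesis-24073 · crux · rank 3 · open · by planner
why it might fail: it fails iff RH fails (then no (H, η) works); as a residual its risk is epistemic: no method certifies WeilPositivityOn beyond window ≈ 2.1 (tree H(q) programme) or proves RH above any height.
sources: Bombieri2000Weil, Yoshida1992, PlattTrudgianBLMS2021
[crux] RESIDUAL (RH-implied, declared residual, never staffed): there are H ≥ 16 and η ∈ (0, 1/2]
such that every zero of ζ in the critical strip with |Im s| > H has Re s = 1/2, every zero with |Im
s| ≤ H has Re s = 1/2 or |Re s − 1/2| ≥ η, and Weil positivity holds on the cone of window 10(log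
H)^3/η (prime side: n ≤ H^{10(log H)^2/η}). [difficulty: open-problem] -/
@[route_item "route-RiemannHypothesis-WeilRadar", crux]
def RadarResidual : Prop :=
  ∃ H η : ℝ, 16 ≤ H ∧ 0 < η ∧ η ≤ 1 / 2 ∧ (∀ s : ℂ, riemannZeta s = 0 → 0 < s.re → s.re < 1 → H < |s.im| → s.re = 1 / 2) ∧ (∀ s : ℂ, riemannZeta s = 0 → 0 < s.re → s.re < 1 → |s.im| ≤ H → s.re = 1 / 2 ∨ η ≤ |s.re - 1 / 2|) ∧ Literature.NumberTheory.LFunctions.WeilPositivityOn (10 * Real.log H ^ 3 / η)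

/-- item stmt-RiemannHypothesis-24074 · support · rank 9 · open · by planner
sources: Bombieri2000Weil
[support] WINDOWED POLARISATION: if g is a Weil test function supported in [−a, a] (a ≥ 0) and Weil
positivity holds on [−A, A], then ‖B_g(x)‖ ≤ Re Q(g) for every x with a + |x| ≤ A (the tree's
`norm_expSum_le` with the support of `translateMix g c x` tracked; explicit formula
`explicit_formula_holds` identifies W(h⋆h̃) with Q(h)). [difficulty: provable-now] -/
@[route_item "route-RiemannHypothesis-WeilRadar", crux]
def TranslateMixWindow : Prop :=
  ∀ (a A : ℝ) (g : ℝ → ℂ), Literature.NumberTheory.LFunctions.IsWeilTest g → tsupport g ⊆ Set.Icc (-a) a → 0 ≤ a → Literature.NumberTheory.LFunctions.WeilPositivityOn A → ∀ x : ℝ, a + |x| ≤ A → ‖Literature.NumberTheory.LFunctions.WeilConverse.expSum g x‖ ≤ (Literature.NumberTheory.LFunctions.WeilConverse.zeroForm g).re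

/-- item stmt-RiemannHypothesis-24075 · assembly · rank 1 · closed · proved by Summit.RiemannHypothesis.RiemannHypothesis.Theorems.WeilRadar.assembly_proof (prover) · by planner
sources: Bombieri2000Weil
[assembly] TranslateMixWindow → RadarGrowth → RadarResidual → RH. -/
@[route_item "route-RiemannHypothesis-WeilRadar"]
def Assembly : Prop :=
  TranslateMixWindow → RadarGrowth → RadarResidual → Summit.RiemannHypothesis

-- `Assembly` holds: proved by `Summit.RiemannHypothesis.RiemannHypothesis.Theorems.WeilRadar.assembly_proof` (its module imports this route file, so no `_holds` link can be stated here).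

/-! D-0027 §2.1 — DECIDING THEOREM (planner-authored via `route open/edit --closes-file`; by planner-rh-idea-9-g3-0 2026-08-28T00:23:00Z):
its hypotheses are this route's items and its conclusion the sub-problem Statement (glue_lint), and it elaborates with this file. -/

@[closes "route-RiemannHypothesis-WeilRadar"] theorem closes (h1 : TranslateMixWindow) (h2 : RadarGrowth) (h3 : RadarResidual) :
    Summit.RiemannHypothesis := by
  rw [Summit.RiemannHypothesis_iff,
    show _root_.RiemannHypothesis ↔ Literature.NumberTheory.LFunctions.RiemannHypothesisStrip from
      Literature.NumberTheory.LFunctions.riemannHypothesis_iff_strip_holds]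
  intro s hs h0 h1'
  obtain ⟨H, η, hH, hη, hη2, hAbove, hFloor, hWP⟩ := h3
  by_cases hhi : H < |s.im|
  · exact hAbove s hs h0 h1' hhi
  · rw [not_lt] at hhi
    rcases hFloor s hs h0 h1' hhi with h | h
    · exact h
    · exfalso
      obtain ⟨g, hg, hsupp, x, hx, hlt⟩ := h2 η H hη hη2 hH s hs h0 h1' hhi h
      have hle := h1 1 (10 * Real.log H ^ 3 / η) g hg hsupp (by norm_num) hWP x hx
      linarith

end Summit.RiemannHypothesis.RiemannHypothesis.Theses.WeilRadar
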